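import Literature.Analysis.FluidPDE.JiaSverak2013Lemma8WindowBounds
import Literature.Analysis.FluidPDE.JiaSverak2013Lemma8RemainderBound
import Literature.Analysis.FluidPDE.JiaSverak2013Lemma8Layer
import Literature.Analysis.FluidPDE.JiaSverak2013CorollaryOneHolds
import Literature.Analysis.FluidPDE.JiaSverak2013Compactness
import Literature.Analysis.FluidPDE.HeatFlowGigaL5
import Literature.Analysis.FluidPDE.LocalLerayPressureRenormalisation
import Literature.Analysis.FluidPDE.JiaSverak2014SlabPressureGauge
import HarnessLib

/-!
# Jia–Šverák's Lemma 8: the discharge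

Analysis/FluidPDE proof file (theorems only, no definitions, no named facts) proving the named
fact `Literature.Analysis.FluidPDE.jia_sverak_2013_lemma_8` (H. Jia, V. Šverák, SIAM J. Math.
Anal. 45 (2013), Lemma 8 = Lemma 1: near the initial time a Leray solution `u ∈ 𝒩(u₀)`,
`u₀ ∈ L³` weakly divergence free, stays close in `L²(B₁(x₀))` to the caloric extension
`e^{tΔ}u₀`, uniformly in `x₀` and in `‖u₀‖₃ ≤ M`: `‖u(t) - e^{tΔ}u₀‖_{L²(B₁(x₀))} ≤ h_M(t)` for
a.e. `t ∈ (0,1)`, `h_M(t) → 0`).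

The argument is the linear comparison of the local energy theory (Lemarié-Rieusset 2016, proof
of Thm. 14.7, pp. 515–518; Seregin–Šverák 2017, proof of (1.7); Jia–Šverák write "the routine
calculations are omitted"): with `e = e^{tΔ}u₀` and `w = u - e`,

1. the local energy inequality of `w` tested with `σ_{δ,τ}(t) θ(x)`, `θ = (cutoff 1 (· - x₀))²`,
   gives the windowed energy bound (`IsLocalLeraySolutionOn.windowed_energy_bound`,
   `JiaSverak2013Lemma8WindowBounds.lean`), the critical coupling `∫ θ⟪De(w), w⟫` having been
   integrated by parts onto `w` and absorbed (`JiaSverak2013Lemma8SliceTools.lean`), with the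
   Gronwall weight `K₀ ‖e(t)‖₅⁵ ∈ L¹(0,∞)` (Giga, `HeatFlowGigaL5.lean`);
2. the lower-order remainder is `≤ a_M(τ) → 0` uniformly under Jia–Šverák's Corollary 1
   (`jia_sverak_2013_corollary_1_holds`; `remainder_integral_bound`,
   `JiaSverak2013Lemma8RemainderBound.lean`), after renormalising the pressure by the gauge of
   Corollary 1 (`IsLocalLeraySolution.sub_pressure`);
3. letting `δ → 0` at the Lebesgue points of `Y(t) = ∫ θ|w(t)|²` and Grönwall's inequality
   (`decay_of_window`, `JiaSverak2013Lemma8Layer.lean`) give `Y(τ) ≤ a_M(τ) e^{1 + K₀ C_G M⁵}`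
   for a.e. `τ ∈ (0,1)`, whence the claim with `h_M = (a_M e^{1 + K₀ C_G M⁵})^{1/2}` since
   `θ = 1` on `B₁(x₀)`.

## References

* H. Jia, V. Šverák, *Minimal L³-initial data for potential Navier–Stokes singularities*, SIAM J.
  Math. Anal. 45 (2013) 1448–1459 = arXiv:1201.1592, Lemma 8 (p. 7), Corollary 1 (p. 4).
  [JiaSverak2013]
* P. G. Lemarié-Rieusset, *The Navier–Stokes problem in the 21st century*, CRC Press 2016,
  Thm. 14.7 (proof, pp. 515–518), Prop. 15.1. [LemarieRieusset2016]
* G. Seregin, V. Šverák, Nonlinear Anal. 154 (2017) 269–296 = arXiv:1601.03096, §1 (1.7).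
  [SereginSverak2017]
* Y. Giga, J. Differential Equations 62 (1986) 186–212 (the `L⁵_{t,x}` bound of the heat flow of
  `L³` data). [Giga1986]
-/

noncomputable section

open MeasureTheory TopologicalSpace Set Function Filter Metric InnerProductSpace
open _root_.Topology
open scoped ENNReal NNReal RealInnerProductSpace

namespace Literature.Analysis.FluidPDE

open FunctionSpaces

/-! ## Tools -/

section Tools

/-- `∫⁻ ‖g‖ₑ² ≤ (∫⁻ ‖g‖ₑ³)^{2/3} μ(univ)^{1/3}` (Hölder `(3/2, 3)` against `1`); private copy of the
tool of `JiaSverak2013Lemma8RemainderBound.lean`. [folklore] -/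
private theorem lintegral_enorm_sq_le_cube_rpow' {X F : Type*} [MeasurableSpace X] {μ : Measure X}
    [NormedAddCommGroup F] [MeasurableSpace F] [BorelSpace F] {g : X → F}
    (hg : AEStronglyMeasurable g μ) :
    ∫⁻ x, ‖g x‖ₑ ^ 2 ∂μ ≤ (∫⁻ x, ‖g x‖ₑ ^ 3 ∂μ) ^ (2 / 3 : ℝ) * (μ univ) ^ (1 / 3 : ℝ) := by
  have h := lintegral_mul_le_L32_L3 (μ := μ) (f := fun x => ‖g x‖ₑ ^ 2) (g := fun _ => 1)
    (hg.aemeasurable.enorm.pow_const _) aemeasurable_const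
  simp only [mul_one, one_pow, lintegral_const, one_mul] at h
  have e : ∀ x, (‖g x‖ₑ ^ 2) ^ (3 / 2 : ℝ) = ‖g x‖ₑ ^ 3 := fun x => by
    rw [← ENNReal.rpow_natCast _ 2, ← ENNReal.rpow_mul, ← ENNReal.rpow_natCast _ 3]; norm_num
  simp only [e] at h
  exact h

/-- `∫⁻ ‖f‖ₑ³ = ‖f‖₃³`. [folklore] -/
private theorem lintegral_enorm_pow_three_eq {X F : Type*} [MeasurableSpace X] {μ : Measure X}
    [NormedAddCommGroup F] (f : X → F) : ∫⁻ x, ‖f x‖ₑ ^ 3 ∂μ = eLpNorm f 3 μ ^ 3 := by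
  have h1 : eLpNorm f 3 μ = (∫⁻ x, ‖f x‖ₑ ^ 3 ∂μ) ^ (1 / 3 : ℝ) := by
    rw [eLpNorm_eq_lintegral_rpow_enorm_toReal (by norm_num) (by norm_num)]
    simp only [ENNReal.toReal_ofNat, ENNReal.rpow_ofNat]
  rw [h1, ← ENNReal.rpow_natCast _ 3, ← ENNReal.rpow_mul]
  norm_num

/-- On a set of finite measure, `∫⁻_B ‖g‖ₑ² ≤ ‖g‖₃² |B|^{1/3}`. [folklore] -/
private theorem setLIntegral_enorm_sq_le_eLpNorm_three_sq {F : Type*} [NormedAddCommGroup F]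
    [MeasurableSpace F] [BorelSpace F] {g : EuclideanSpace ℝ (Fin 3) → F}
    {B : Set (EuclideanSpace ℝ (Fin 3))} (hg : AEStronglyMeasurable g (volume.restrict B)) :
    ∫⁻ x in B, ‖g x‖ₑ ^ 2 ≤ eLpNorm g 3 volume ^ 2 * volume B ^ (1 / 3 : ℝ) := by
  have h1 := lintegral_enorm_sq_le_cube_rpow' (μ := volume.restrict B) hg
  rw [Measure.restrict_apply_univ] at h1
  refine h1.trans (mul_le_mul' ?_ le_rfl)
  have h2 : (∫⁻ x in B, ‖g x‖ₑ ^ 3) ≤ eLpNorm g 3 volume ^ 3 := by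
    rw [← lintegral_enorm_pow_three_eq]
    exact lintegral_mono' Measure.restrict_le_self le_rfl
  calc (∫⁻ x in B, ‖g x‖ₑ ^ 3) ^ (2 / 3 : ℝ) ≤ (eLpNorm g 3 volume ^ 3) ^ (2 / 3 : ℝ) :=
        ENNReal.rpow_le_rpow h2 (by norm_num)
    _ = eLpNorm g 3 volume ^ 2 := by
        rw [← ENNReal.rpow_natCast _ 3, ← ENNReal.rpow_mul, ← ENNReal.rpow_natCast _ 2]; norm_num

/-- `∫⁻_B ‖U - E‖ₑ² ≤ 2 ∫⁻_B ‖U - g‖ₑ² + 2 ∫⁻_B ‖E - g‖ₑ²` when the second difference is measurable.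
[folklore] -/
private theorem setLIntegral_enorm_sub_sq_le {X F : Type*} [MeasurableSpace X] {μ : Measure X}
    [NormedAddCommGroup F] {U V g : X → F}
    (hm : AEMeasurable (fun x => ‖V x - g x‖ₑ ^ 2) μ) :
    ∫⁻ x, ‖U x - V x‖ₑ ^ 2 ∂μ ≤ 2 * ∫⁻ x, ‖U x - g x‖ₑ ^ 2 ∂μ + 2 * ∫⁻ x, ‖V x - g x‖ₑ ^ 2 ∂μ := by
  have hpt : ∀ x, ‖U x - V x‖ₑ ^ 2 ≤ 2 * ‖U x - g x‖ₑ ^ 2 + 2 * ‖V x - g x‖ₑ ^ 2 := by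
    intro x
    have h : ‖(U x - g x) - (V x - g x)‖ ^ 2 ≤ 2 * ‖U x - g x‖ ^ 2 + 2 * ‖V x - g x‖ ^ 2 := by
      nlinarith [norm_sub_le (U x - g x) (V x - g x), sq_nonneg (‖U x - g x‖ - ‖V x - g x‖),
        norm_nonneg ((U x - g x) - (V x - g x)), norm_nonneg (U x - g x), norm_nonneg (V x - g x)]
    rw [sub_sub_sub_cancel_right] at h
    calc ‖U x - V x‖ₑ ^ 2 = ENNReal.ofReal (‖U x - V x‖ ^ 2) := by
          rw [← ofReal_norm, ENNReal.ofReal_pow (norm_nonneg _)]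
      _ ≤ ENNReal.ofReal (2 * ‖U x - g x‖ ^ 2 + 2 * ‖V x - g x‖ ^ 2) := ENNReal.ofReal_le_ofReal h
      _ = 2 * ‖U x - g x‖ₑ ^ 2 + 2 * ‖V x - g x‖ₑ ^ 2 := by
          rw [ENNReal.ofReal_add (by positivity) (by positivity), ENNReal.ofReal_mul zero_le_two,
            ENNReal.ofReal_mul zero_le_two, ENNReal.ofReal_pow (norm_nonneg _),
            ENNReal.ofReal_pow (norm_nonneg _), ofReal_norm, ofReal_norm, ENNReal.ofReal_ofNat]
  calc ∫⁻ x, ‖U x - V x‖ₑ ^ 2 ∂μ ≤ ∫⁻ x, (2 * ‖U x - g x‖ₑ ^ 2 + 2 * ‖V x - g x‖ₑ ^ 2) ∂μ :=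
        lintegral_mono hpt
    _ = 2 * ∫⁻ x, ‖U x - g x‖ₑ ^ 2 ∂μ + 2 * ∫⁻ x, ‖V x - g x‖ₑ ^ 2 ∂μ := by
        rw [lintegral_add_right' _ (hm.const_mul _), lintegral_const_mul' _ _ (by simp),
          lintegral_const_mul' _ _ (by simp)]

/-- `ENNReal.ofReal (∫ f) ≤ ∫⁻ ENNReal.ofReal f` for `f ≥ 0` (no integrability needed). [folklore] -/
private theorem ofReal_integral_le_lintegral_ofReal' {X : Type*} [MeasurableSpace X] {μ : Measure X}
    {f : X → ℝ} (hf : ∀ x, 0 ≤ f x) :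
    ENNReal.ofReal (∫ x, f x ∂μ) ≤ ∫⁻ x, ENNReal.ofReal (f x) ∂μ := by
  rw [← Real.enorm_eq_ofReal (integral_nonneg hf)]
  refine (enorm_integral_le_lintegral_enorm f).trans (le_of_eq (lintegral_congr fun x => ?_))
  exact Real.enorm_eq_ofReal (hf x)

end Tools

/-! ## The discharge -/

section Main

set_option maxHeartbeats 3200000 in
/-- **Jia–Šverák's Lemma 8 holds** (discharge of the named fact
`Literature.Analysis.FluidPDE.jia_sverak_2013_lemma_8`; H. Jia, V. Šverák 2013, Lemma 8 = Lemma 1;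
proof by the linear comparison of Lemarié-Rieusset 2016, Thm. 14.7, pp. 515–518, and
Seregin–Šverák 2017, (1.7), see the module docstring).
[cite: JiaSverak2013, Lemma 8 (arXiv:1201.1592 p. 7)] -/
theorem jia_sverak_2013_lemma_8_holds : jia_sverak_2013_lemma_8 := by
  intro M
  -- ### the constants
  obtain ⟨C, hCor⟩ := jia_sverak_2013_corollary_1_holds
  obtain ⟨c₁, cΔ, hc₁, hcΔ, hcut⟩ := exists_cutoff_translate_bounds
  obtain ⟨K₀, hK₀, htri⟩ := two_mul_abs_integral_sq_mul_inner_apply_le (3 : ℝ)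
  obtain ⟨CG, hCGtop, hGiga⟩ := lintegral_Ioi_eLpNorm_heatExtension_pow_five_le
    (E := EuclideanSpace ℝ (Fin 3)) (F := EuclideanSpace ℝ (Fin 3)) finrank_euclideanSpace_fin
  set EM : ℝ≥0 := 2 * (C * M ^ 2 * max (M ^ 2) 1 * 3) with hEM
  set AM : ℝ≥0 := C * M ^ 2 * max (M ^ 2) 1 * 3 with hAM
  set PM : ℝ≥0 := C * M ^ 3 * max (M ^ 4) 1 * 9 with hPM
  obtain ⟨a, ha0, hmono, hlim, hrem⟩ := remainder_integral_bound M EM AM PM hc₁ hcΔ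
  have hCGM : CG * (M : ℝ≥0∞) ^ 5 ≠ ⊤ := ENNReal.mul_ne_top hCGtop.ne (ENNReal.pow_ne_top ENNReal.coe_ne_top)
  set Kexp : ℝ := Real.exp (1 + K₀ * (CG * (M : ℝ≥0∞) ^ 5).toReal) with hKexp
  have hKexp0 : 0 ≤ Kexp := Real.exp_nonneg _
  refine ⟨fun t => (Real.sqrt (a t * Kexp)).toNNReal, ?_, ?_⟩
  · -- `h_M(t) → 0`
    have h1 : Tendsto (fun t => a t * Kexp) (𝓝[>] 0) (𝓝 0) := by
      simpa using hlim.mul_const Kexp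
    have h2 := ((continuous_real_toNNReal.comp Real.continuous_sqrt).tendsto 0).comp h1
    have h3 : (Real.toNNReal ∘ Real.sqrt) 0 = 0 := by simp
    rw [h3] at h2
    exact h2
  intro u₀ u p hu₀ hdiv hM hsol x₀
  have hν : (0 : ℝ) < 1 := one_pos
  -- ### Corollary 1 at radius `3` and centre `x₀`
  have hαM : (eLpNorm u₀ 3 volume).toNNReal ≤ M := by
    have := ENNReal.toNNReal_mono ENNReal.coe_ne_top hM
    rwa [ENNReal.toNNReal_coe] at this
  obtain ⟨G, hGslab, hCr⟩ := hCor u₀ u p hu₀ hdiv hsol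
  obtain ⟨hE9, hA9, c, hcm, hP9⟩ := hCr 3 (by norm_num) x₀
  have hα2 : (eLpNorm u₀ 3 volume).toNNReal ^ 2 ≤ M ^ 2 := pow_le_pow_left' hαM 2
  have hα3 : (eLpNorm u₀ 3 volume).toNNReal ^ 3 ≤ M ^ 3 := pow_le_pow_left' hαM 3
  have hα4 : (eLpNorm u₀ 3 volume).toNNReal ^ 4 ≤ M ^ 4 := pow_le_pow_left' hαM 4
  have h3 : (3 : ℝ).toNNReal = 3 := by simp
  have h9 : ((3 : ℝ) ^ 2).toNNReal = 9 := by norm_num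
  have hEle : (2 * (C * (eLpNorm u₀ 3 volume).toNNReal ^ 2 *
      max ((eLpNorm u₀ 3 volume).toNNReal ^ 2) 1 * (3 : ℝ).toNNReal) : ℝ≥0) ≤ EM := by
    rw [hEM, h3]
    exact mul_le_mul' le_rfl (mul_le_mul' (mul_le_mul' (mul_le_mul' le_rfl hα2)
      (max_le_max hα2 le_rfl)) le_rfl)
  have hAle : (C * (eLpNorm u₀ 3 volume).toNNReal ^ 2 *
      max ((eLpNorm u₀ 3 volume).toNNReal ^ 2) 1 * (3 : ℝ).toNNReal : ℝ≥0) ≤ AM := by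
    rw [hAM, h3]
    exact mul_le_mul' (mul_le_mul' (mul_le_mul' le_rfl hα2) (max_le_max hα2 le_rfl)) le_rfl
  have hPle : (C * (eLpNorm u₀ 3 volume).toNNReal ^ 3 *
      max ((eLpNorm u₀ 3 volume).toNNReal ^ 4) 1 * ((3 : ℝ) ^ 2).toNNReal : ℝ≥0) ≤ PM := by
    rw [hPM, h9]
    exact mul_le_mul' (mul_le_mul' (mul_le_mul' le_rfl hα3) (max_le_max hα4 le_rfl)) le_rfl
  have h29 : Ioo (0 : ℝ) 2 ⊆ Ioo 0 (3 ^ 2) := Ioo_subset_Ioo le_rfl (by norm_num)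
  have hE2 : ∀ᵐ t ∂(volume.restrict (Ioo (0 : ℝ) 2)), ∫⁻ x in ball x₀ 3, ‖u t x‖ₑ ^ 2 ≤ EM := by
    filter_upwards [ae_restrict_of_ae_restrict_of_subset h29 hE9] with t ht
    exact ht.trans (ENNReal.coe_le_coe.2 hEle)
  have hA2 : ∫⁻ z in Ioo (0 : ℝ) 2 ×ˢ ball x₀ 3, ENNReal.ofReal (frobeniusNormSq (G z.1 z.2)) ≤ AM :=
    (lintegral_mono_set (prod_mono h29 Subset.rfl)).trans (hA9.trans (ENNReal.coe_le_coe.2 hAle))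
  have hS9 : (3 : ℝ) ^ 2 = 9 := by norm_num
  have hP9' : ∫⁻ z in Ioo (0 : ℝ) 9 ×ˢ ball x₀ 3, ‖p z.1 z.2 - c z.1‖ₑ ^ (3 / 2 : ℝ) ≤ PM := by
    rw [← hS9]
    exact hP9.trans (ENNReal.coe_le_coe.2 hPle)
  -- ### the gauge of Corollary 1, cut off at `t = 9`, and the renormalised pressure
  set c' : ℝ → ℝ := (Ioo (0 : ℝ) 9).indicator c with hc'
  have hc'm : Measurable c' := hcm.indicator measurableSet_Ioo
  have s2top : (2 : ℝ≥0∞) ^ (1 / 2 : ℝ) ≠ ⊤ :=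
    ENNReal.rpow_ne_top_of_nonneg (by norm_num) ENNReal.ofNat_ne_top
  have hpmS : ∀ (T : ℝ) (B : Set (EuclideanSpace ℝ (Fin 3))),
      AEMeasurable (fun z : ℝ × EuclideanSpace ℝ (Fin 3) => ‖p z.1 z.2‖ₑ ^ (3 / 2 : ℝ))
        (volume.restrict (Ioo 0 T ×ˢ B)) := by
    intro T B
    have h := (hsol.isLocalLeraySolutionOn T).aestronglyMeasurable_pressure_box B
    rw [Measure.prod_restrict, ← Measure.volume_eq_prod] at h
    exact h.aemeasurable.enorm.pow_const _
  have hcfin : ∫⁻ t in Ioo (0 : ℝ) 9, ‖c t‖ₑ ^ (3 / 2 : ℝ) < ∞ := by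
    set S : Set (ℝ × EuclideanSpace ℝ (Fin 3)) := Ioo (0 : ℝ) 9 ×ˢ ball x₀ 3 with hS
    have hpt : ∀ z : ℝ × EuclideanSpace ℝ (Fin 3), ‖c z.1‖ₑ ^ (3 / 2 : ℝ) ≤
        (2 : ℝ≥0∞) ^ (1 / 2 : ℝ) * ‖p z.1 z.2‖ₑ ^ (3 / 2 : ℝ) +
          (2 : ℝ≥0∞) ^ (1 / 2 : ℝ) * ‖p z.1 z.2 - c z.1‖ₑ ^ (3 / 2 : ℝ) := fun z => by
      have h := enorm_sub_rpow_threeHalves_le (p z.1 z.2) (p z.1 z.2 - c z.1)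
      rw [sub_sub_cancel] at h
      rw [← mul_add]
      exact h
    have hp32 : ∫⁻ z in S, ‖p z.1 z.2‖ₑ ^ (3 / 2 : ℝ) < ∞ :=
      (lintegral_mono_set (Set.prod_mono Subset.rfl ball_subset_closedBall)).trans_lt
        (hsol.pressure 9 (by norm_num) _ (isCompact_closedBall _ _))
    have hSfin : ∫⁻ z in S, ‖c z.1‖ₑ ^ (3 / 2 : ℝ) < ∞ := by
      calc ∫⁻ z in S, ‖c z.1‖ₑ ^ (3 / 2 : ℝ)
          ≤ ∫⁻ z in S, ((2 : ℝ≥0∞) ^ (1 / 2 : ℝ) * ‖p z.1 z.2‖ₑ ^ (3 / 2 : ℝ) +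
              (2 : ℝ≥0∞) ^ (1 / 2 : ℝ) * ‖p z.1 z.2 - c z.1‖ₑ ^ (3 / 2 : ℝ)) := lintegral_mono hpt
        _ = (2 : ℝ≥0∞) ^ (1 / 2 : ℝ) * (∫⁻ z in S, ‖p z.1 z.2‖ₑ ^ (3 / 2 : ℝ)) +
              (2 : ℝ≥0∞) ^ (1 / 2 : ℝ) * ∫⁻ z in S, ‖p z.1 z.2 - c z.1‖ₑ ^ (3 / 2 : ℝ) := by
            rw [lintegral_add_left' ((hpmS 9 _).const_mul _), lintegral_const_mul'' _ (hpmS 9 _),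
              lintegral_const_mul' _ _ s2top]
        _ < ∞ := ENNReal.add_lt_top.2 ⟨ENNReal.mul_lt_top (lt_top_iff_ne_top.2 s2top) hp32,
              ENNReal.mul_lt_top (lt_top_iff_ne_top.2 s2top) (hP9'.trans_lt ENNReal.coe_lt_top)⟩
    rw [hS, lintegral_prod_of_time_only (g := fun t => ‖c t‖ₑ ^ (3 / 2 : ℝ))
      (hcm.enorm.pow_const _)] at hSfin
    have hvol : volume (ball x₀ 3) ≠ 0 := (measure_ball_pos volume x₀ (by norm_num)).ne'
    rcases ENNReal.mul_lt_top_iff.1 hSfin with h | h | h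
    · exact h.1
    · simp [h]
    · exact absurd h hvol
  have hfin' : ∀ T R : ℝ, 0 < T → 0 < R →
      ∫⁻ z in Ioo 0 T ×ˢ ball (0 : EuclideanSpace ℝ (Fin 3)) R,
        ‖p z.1 z.2 - c' z.1‖ₑ ^ (3 / 2 : ℝ) < ∞ := by
    intro T R hT hR
    set S : Set (ℝ × EuclideanSpace ℝ (Fin 3)) := Ioo 0 T ×ˢ ball (0 : EuclideanSpace ℝ (Fin 3)) R
      with hS
    have hp32 : ∫⁻ z in S, ‖p z.1 z.2‖ₑ ^ (3 / 2 : ℝ) < ∞ :=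
      (lintegral_mono_set (Set.prod_mono Subset.rfl ball_subset_closedBall)).trans_lt
        (hsol.pressure T hT _ (isCompact_closedBall _ _))
    have hc'32 : ∫⁻ z in S, ‖c' z.1‖ₑ ^ (3 / 2 : ℝ) < ∞ := by
      rw [hS, lintegral_prod_of_time_only (g := fun t => ‖c' t‖ₑ ^ (3 / 2 : ℝ))
        (hc'm.enorm.pow_const _)]
      refine ENNReal.mul_lt_top ?_ measure_ball_lt_top
      calc ∫⁻ t in Ioo 0 T, ‖c' t‖ₑ ^ (3 / 2 : ℝ) ≤ ∫⁻ t, ‖c' t‖ₑ ^ (3 / 2 : ℝ) :=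
            lintegral_mono' Measure.restrict_le_self le_rfl
        _ = ∫⁻ t in Ioo (0 : ℝ) 9, ‖c t‖ₑ ^ (3 / 2 : ℝ) := by
            rw [← lintegral_indicator measurableSet_Ioo]
            refine lintegral_congr fun t => ?_
            by_cases ht : t ∈ Ioo (0 : ℝ) 9
            · rw [indicator_of_mem ht, hc', indicator_of_mem ht]
            · rw [indicator_of_notMem ht, hc', indicator_of_notMem ht, enorm_zero,
                ENNReal.zero_rpow_of_pos (by norm_num)]
        _ < ∞ := hcfin
    have hpt : ∀ z : ℝ × EuclideanSpace ℝ (Fin 3), ‖p z.1 z.2 - c' z.1‖ₑ ^ (3 / 2 : ℝ) ≤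
        (2 : ℝ≥0∞) ^ (1 / 2 : ℝ) * ‖p z.1 z.2‖ₑ ^ (3 / 2 : ℝ) +
          (2 : ℝ≥0∞) ^ (1 / 2 : ℝ) * ‖c' z.1‖ₑ ^ (3 / 2 : ℝ) := fun z => by
      rw [← mul_add]; exact enorm_sub_rpow_threeHalves_le _ _
    calc ∫⁻ z in S, ‖p z.1 z.2 - c' z.1‖ₑ ^ (3 / 2 : ℝ)
        ≤ ∫⁻ z in S, ((2 : ℝ≥0∞) ^ (1 / 2 : ℝ) * ‖p z.1 z.2‖ₑ ^ (3 / 2 : ℝ) +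
            (2 : ℝ≥0∞) ^ (1 / 2 : ℝ) * ‖c' z.1‖ₑ ^ (3 / 2 : ℝ)) := lintegral_mono hpt
      _ = (2 : ℝ≥0∞) ^ (1 / 2 : ℝ) * (∫⁻ z in S, ‖p z.1 z.2‖ₑ ^ (3 / 2 : ℝ)) +
            (2 : ℝ≥0∞) ^ (1 / 2 : ℝ) * ∫⁻ z in S, ‖c' z.1‖ₑ ^ (3 / 2 : ℝ) := by
          rw [lintegral_add_left' ((hpmS T _).const_mul _), lintegral_const_mul'' _ (hpmS T _),
            lintegral_const_mul' _ _ s2top]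
      _ < ∞ := ENNReal.add_lt_top.2 ⟨ENNReal.mul_lt_top (lt_top_iff_ne_top.2 s2top) hp32,
            ENNReal.mul_lt_top (lt_top_iff_ne_top.2 s2top) hc'32⟩
  have hsol' : IsLocalLeraySolution 1 u₀ u (fun t x => p t x - c' t) := hsol.sub_pressure hc'm hfin'
  have h2 : IsLocalLeraySolutionOn 2 1 u₀ u (fun t x => p t x - c' t) := hsol'.isLocalLeraySolutionOn 2
  have hP2 : ∫⁻ z in Ioo (0 : ℝ) 2 ×ˢ ball x₀ 3, ‖p z.1 z.2 - c' z.1‖ₑ ^ (3 / 2 : ℝ) ≤ PM := by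
    calc ∫⁻ z in Ioo (0 : ℝ) 2 ×ˢ ball x₀ 3, ‖p z.1 z.2 - c' z.1‖ₑ ^ (3 / 2 : ℝ)
        = ∫⁻ z in Ioo (0 : ℝ) 2 ×ˢ ball x₀ 3, ‖p z.1 z.2 - c z.1‖ₑ ^ (3 / 2 : ℝ) := by
          refine setLIntegral_congr_fun (measurableSet_Ioo.prod measurableSet_ball) fun z hz => ?_
          have hz9 : z.1 ∈ Ioo (0 : ℝ) 9 := ⟨hz.1.1, hz.1.2.trans (by norm_num)⟩
          simp only [hc', indicator_of_mem hz9]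
      _ ≤ ∫⁻ z in Ioo (0 : ℝ) 9 ×ˢ ball x₀ 3, ‖p z.1 z.2 - c z.1‖ₑ ^ (3 / 2 : ℝ) :=
          lintegral_mono_set (prod_mono (Ioo_subset_Ioo le_rfl (by norm_num)) Subset.rfl)
      _ ≤ PM := hP9'
  -- ### the gradient of the renormalised solution carrying the local energy inequality
  obtain ⟨G', hG', hG'2, hLEI'⟩ := h2.suitable.localEnergy
  have hGT : HasWeakSpatialGradientOn (slab (EuclideanSpace ℝ (Fin 3)) (Ioo 0 2) isOpen_Ioo) u G :=
    hGslab.mono (slab_mono Ioo_subset_Ioi_self)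
  -- ### the objects `e`, `Y`, `P`
  set e : ℝ → EuclideanSpace ℝ (Fin 3) → EuclideanSpace ℝ (Fin 3) := fun t => heatFlow u₀ (1 * t)
    with hedef
  have he_app : ∀ t, heatFlow u₀ (1 * t) = e t := fun t => rfl
  set Y : ℝ → ℝ := fun t => ∫ x, cutoff (1 : ℝ) (x - x₀) ^ 2 * ‖u t x - e t x‖ ^ 2 with hYdef
  set P : ℝ → ℝ := fun t => (eLpNorm (e t) 5 volume).toReal ^ 5 with hPdef
  set V : ℝ≥0∞ := volume (ball x₀ (3 : ℝ)) with hV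
  have hVfin : V ≠ ⊤ := measure_ball_lt_top.ne
  have hV3fin : V ^ (1 / 3 : ℝ) ≠ ⊤ := ENNReal.rpow_ne_top_of_nonneg (by norm_num) hVfin
  -- facts on the caloric extension
  have he_pos : ∀ t, 0 < t → e t = UnboundedOperators.heatExtension u₀ (1 * t) := fun t ht => by
    rw [hedef]; exact heatFlow_of_pos u₀ (by linarith)
  have he3 : ∀ t, 0 ≤ t → eLpNorm (e t) 3 volume ≤ M := fun t ht =>
    (eLpNorm_heatFlow_le_holds hu₀ (by norm_num) (by positivity : (0 : ℝ) ≤ 1 * t)).trans hM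
  have he_cont : ∀ t, 0 < t → Continuous (e t) := fun t ht => by
    rw [he_pos t ht]
    exact (UnboundedOperators.contDiff_heatExtension_holds hu₀ (by norm_num) (by linarith)).continuous
  have hM2V : ∀ t, 0 < t → ∫⁻ x in ball x₀ 3, ‖e t x‖ₑ ^ 2 ≤ (M : ℝ≥0∞) ^ 2 * V ^ (1 / 3 : ℝ) := by
    intro t ht
    refine (setLIntegral_enorm_sq_le_eLpNorm_three_sq (he_cont t ht).aestronglyMeasurable).trans ?_
    exact mul_le_mul' (pow_le_pow_left' (he3 t ht.le) 2) le_rfl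
  -- θ facts
  have hθ1 : ∀ x, cutoff (1 : ℝ) (x - x₀) ^ 2 ≤ 1 := fun x =>
    pow_le_one₀ (cutoff_nonneg _ _) (cutoff_le_one _ _)
  have hθ0 : ∀ x, x ∉ ball x₀ 3 → cutoff (1 : ℝ) (x - x₀) = 0 := by
    intro x hx
    refine cutoff_eq_zero one_pos ?_
    rw [mem_ball, dist_eq_norm] at hx
    linarith [not_lt.1 hx]
  have hθone : ∀ x, x ∈ ball x₀ 1 → cutoff (1 : ℝ) (x - x₀) = 1 := by
    intro x hx
    refine cutoff_eq_one one_pos ?_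
    rw [mem_ball, dist_eq_norm] at hx
    exact hx.le
  -- ### `Y ≥ 0`, `ofReal Y ≤ ∫_{B₃} |w|²`
  have hY0 : ∀ t, 0 ≤ Y t := fun t => integral_nonneg fun x => by positivity
  have hYle : ∀ t, ENNReal.ofReal (Y t) ≤ ∫⁻ x in ball x₀ 3, ‖u t x - e t x‖ₑ ^ 2 := by
    intro t
    calc ENNReal.ofReal (Y t)
        ≤ ∫⁻ x, ENNReal.ofReal (cutoff (1 : ℝ) (x - x₀) ^ 2 * ‖u t x - e t x‖ ^ 2) :=
          ofReal_integral_le_lintegral_ofReal' fun x => by positivity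
      _ ≤ ∫⁻ x, (ball x₀ 3).indicator (fun x => ‖u t x - e t x‖ₑ ^ 2) x := by
          refine lintegral_mono fun x => ?_
          by_cases hx : x ∈ ball x₀ 3
          · rw [indicator_of_mem hx, ← ofReal_norm, ← ENNReal.ofReal_pow (norm_nonneg _)]
            exact ENNReal.ofReal_le_ofReal (mul_le_of_le_one_left (sq_nonneg _) (hθ1 x))
          · rw [indicator_of_notMem hx, hθ0 x hx]
            simp
      _ = ∫⁻ x in ball x₀ 3, ‖u t x - e t x‖ₑ ^ 2 := lintegral_indicator measurableSet_ball _
  -- ### slices of `u`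
  have h1 : IsLocalLeraySolutionOn 1 1 u₀ u p := hsol.isLocalLeraySolutionOn 1
  have hslice := ae_slice_aestronglyMeasurable_and_lintegral_ball_lt_top h1.aestronglyMeasurable
    (fun K hK => h1.sqIntegrable K hK)
  have hE1 : ∀ᵐ t ∂(volume.restrict (Ioo (0 : ℝ) 1)), ∫⁻ x in ball x₀ 3, ‖u t x‖ₑ ^ 2 ≤ EM :=
    ae_restrict_of_ae_restrict_of_subset (Ioo_subset_Ioo le_rfl (by norm_num)) hE2
  -- ### `Y` is measurable
  have hYm : AEStronglyMeasurable Y (volume.restrict (Ioo (0 : ℝ) 1)) := by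
    have hu1 : AEStronglyMeasurable (uncurry u) (volume.restrict (Ioo (0 : ℝ) 1 ×ˢ univ)) :=
      h1.aestronglyMeasurable
    have he1 : AEStronglyMeasurable (uncurry e) (volume.restrict (Ioo (0 : ℝ) 1 ×ˢ univ)) :=
      aestronglyMeasurable_uncurry_heatFlow hu₀ (by norm_num) hν 1
    have hθ : AEStronglyMeasurable (fun z : ℝ × EuclideanSpace ℝ (Fin 3) => cutoff (1 : ℝ) (z.2 - x₀) ^ 2)
        (volume.restrict (Ioo (0 : ℝ) 1 ×ˢ univ)) :=
      (((contDiff_cutoff (E := EuclideanSpace ℝ (Fin 3)) (n := 0) 1).continuous.comp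
        (continuous_snd.sub continuous_const)).pow 2).aestronglyMeasurable
    have hF : AEStronglyMeasurable (fun z : ℝ × EuclideanSpace ℝ (Fin 3) =>
        cutoff (1 : ℝ) (z.2 - x₀) ^ 2 * ‖u z.1 z.2 - e z.1 z.2‖ ^ 2)
        ((volume.restrict (Ioo (0 : ℝ) 1)).prod volume) := by
      rw [← volume_restrict_slab_eq]
      have h := hθ.mul ((hu1.sub he1).norm.pow 2)
      exact h
    exact hF.integral_prod_right'
  -- ### `Y` is a.e. bounded
  set Yb : ℝ≥0∞ := 2 * (EM : ℝ≥0∞) + 2 * ((M : ℝ≥0∞) ^ 2 * V ^ (1 / 3 : ℝ)) with hYb'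
  have hYbfin : Yb ≠ ⊤ := ENNReal.add_ne_top.2 ⟨ENNReal.mul_ne_top (by simp) ENNReal.coe_ne_top,
    ENNReal.mul_ne_top (by simp) (ENNReal.mul_ne_top (ENNReal.pow_ne_top ENNReal.coe_ne_top) hV3fin)⟩
  have hYb : ∀ᵐ t ∂(volume.restrict (Ioo (0 : ℝ) 1)), Y t ≤ Yb.toReal := by
    filter_upwards [hslice, hE1, ae_restrict_mem measurableSet_Ioo] with t hst hEt ht
    refine (ENNReal.ofReal_le_iff_le_toReal hYbfin).1 ?_
    have hm : AEMeasurable (fun x => ‖e t x - (0 : EuclideanSpace ℝ (Fin 3))‖ₑ ^ 2)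
        (volume.restrict (ball x₀ 3)) :=
      (((he_cont t ht.1).aestronglyMeasurable.sub aestronglyMeasurable_const).aemeasurable.enorm.pow_const _)
    calc ENNReal.ofReal (Y t) ≤ ∫⁻ x in ball x₀ 3, ‖u t x - e t x‖ₑ ^ 2 := hYle t
      _ ≤ (2 * ∫⁻ x in ball x₀ 3, ‖u t x - 0‖ₑ ^ 2) + 2 * ∫⁻ x in ball x₀ 3, ‖e t x - 0‖ₑ ^ 2 :=
          setLIntegral_enorm_sub_sq_le hm
      _ ≤ 2 * (EM : ℝ≥0∞) + 2 * ((M : ℝ≥0∞) ^ 2 * V ^ (1 / 3 : ℝ)) := by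
          simp only [sub_zero]
          exact add_le_add (mul_le_mul' le_rfl hEt) (mul_le_mul' le_rfl (hM2V t ht.1))
  -- ### `Y(t) → 0` as `t → 0⁺`
  have hYlim : Tendsto Y (𝓝[>] 0) (𝓝 0) := by
    have hT1 : Tendsto (fun t => ∫⁻ x in ball x₀ 3, ‖u t x - u₀ x‖ₑ ^ 2) (𝓝[>] 0) (𝓝 0) := by
      have h := hsol.initial (closedBall x₀ 3) (isCompact_closedBall _ _)
      exact tendsto_of_tendsto_of_tendsto_of_le_of_le tendsto_const_nhds h (fun _ => zero_le)
        (fun t => lintegral_mono_set ball_subset_closedBall)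
    have hT2 : Tendsto (fun t => eLpNorm (e t - u₀) 3 volume) (𝓝[>] 0) (𝓝 0) := by
      have h := tendsto_heatFlow_nhdsWithin_zero_holds (E := EuclideanSpace ℝ (Fin 3)) hu₀
        (by norm_num) (by norm_num)
      have h' := h.mono_left (nhdsWithin_mono _ Ioi_subset_Ici_self)
      refine h'.congr fun t => ?_
      simp only [hedef, one_mul]
    have hT2' : Tendsto (fun t => 2 * (eLpNorm (e t - u₀) 3 volume ^ 2 * V ^ (1 / 3 : ℝ)))
        (𝓝[>] 0) (𝓝 0) := by
      have h1 : Tendsto (fun t => eLpNorm (e t - u₀) 3 volume ^ 2) (𝓝[>] 0) (𝓝 0) := by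
        simpa using ENNReal.Tendsto.pow hT2 (n := 2)
      have h2 := ENNReal.Tendsto.mul_const h1 (Or.inr hV3fin)
      rw [zero_mul] at h2
      have h3 := ENNReal.Tendsto.const_mul (a := 2) h2 (Or.inr (by norm_num))
      rw [mul_zero] at h3
      exact h3
    have hT1' : Tendsto (fun t => 2 * ∫⁻ x in ball x₀ 3, ‖u t x - u₀ x‖ₑ ^ 2) (𝓝[>] 0) (𝓝 0) := by
      have h3 := ENNReal.Tendsto.const_mul (a := 2) hT1 (Or.inr (by norm_num))
      rw [mul_zero] at h3
      exact h3
    have hsum := hT1'.add hT2'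
    rw [add_zero] at hsum
    have hup : ∀ᶠ t in 𝓝[>] (0 : ℝ), ENNReal.ofReal (Y t) ≤
        2 * (∫⁻ x in ball x₀ 3, ‖u t x - u₀ x‖ₑ ^ 2) +
          2 * (eLpNorm (e t - u₀) 3 volume ^ 2 * V ^ (1 / 3 : ℝ)) := by
      filter_upwards [self_mem_nhdsWithin] with t ht
      have ht' : 0 < t := ht
      have hme : AEStronglyMeasurable (fun x => e t x - u₀ x) (volume.restrict (ball x₀ 3)) :=
        ((he_cont t ht').aestronglyMeasurable.sub hu₀.1).restrict
      have hm : AEMeasurable (fun x => ‖e t x - u₀ x‖ₑ ^ 2) (volume.restrict (ball x₀ 3)) :=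
        hme.aemeasurable.enorm.pow_const _
      calc ENNReal.ofReal (Y t) ≤ ∫⁻ x in ball x₀ 3, ‖u t x - e t x‖ₑ ^ 2 := hYle t
        _ ≤ (2 * ∫⁻ x in ball x₀ 3, ‖u t x - u₀ x‖ₑ ^ 2) + 2 * ∫⁻ x in ball x₀ 3, ‖e t x - u₀ x‖ₑ ^ 2 :=
            setLIntegral_enorm_sub_sq_le hm
        _ ≤ _ := add_le_add le_rfl (mul_le_mul' le_rfl ?_)
      have h := setLIntegral_enorm_sq_le_eLpNorm_three_sq (B := ball x₀ 3) hme
      exact h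
    have hofY : Tendsto (fun t => ENNReal.ofReal (Y t)) (𝓝[>] 0) (𝓝 0) :=
      tendsto_of_tendsto_of_tendsto_of_le_of_le' tendsto_const_nhds hsum
        (Eventually.of_forall fun _ => zero_le) hup
    have h := (ENNReal.tendsto_toReal ENNReal.zero_ne_top).comp hofY
    rw [ENNReal.toReal_zero] at h
    refine h.congr fun t => ?_
    simp only [Function.comp_apply, ENNReal.toReal_ofReal (hY0 t)]
  -- ### `P ≥ 0`, `∫₀¹ P ≤ C_G M⁵`
  have hP0 : ∀ t, 0 ≤ P t := fun t => by positivity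
  have hPle : ∫⁻ t in Ioo (0 : ℝ) 1, ENNReal.ofReal (P t) ≤ CG * (M : ℝ≥0∞) ^ 5 := by
    calc ∫⁻ t in Ioo (0 : ℝ) 1, ENNReal.ofReal (P t)
        ≤ ∫⁻ t in Ioo (0 : ℝ) 1, eLpNorm (UnboundedOperators.heatExtension u₀ t) 5 volume ^ 5 := by
          refine lintegral_mono_ae ((ae_restrict_iff' measurableSet_Ioo).2 (Eventually.of_forall
            fun t ht => ?_))
          simp only [hPdef]
          rw [he_pos t ht.1, one_mul, ← ENNReal.toReal_pow]
          exact ENNReal.ofReal_toReal_le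
      _ ≤ ∫⁻ t in Ioi (0 : ℝ), eLpNorm (UnboundedOperators.heatExtension u₀ t) 5 volume ^ 5 :=
          lintegral_mono_set Ioo_subset_Ioi_self
      _ ≤ CG * eLpNorm u₀ 3 volume ^ 5 := hGiga hu₀
      _ ≤ CG * (M : ℝ≥0∞) ^ 5 := mul_le_mul' le_rfl (pow_le_pow_left' hM 5)
  have hPfin : ∫⁻ t in Ioo (0 : ℝ) 1, ENNReal.ofReal (P t) < ∞ := hPle.trans_lt hCGM.lt_top
  -- ### the windowed inequalities
  have hwin : ∀ δ τ : ℝ, 0 < δ → 4 * δ ≤ τ → τ < 1 →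
      ∫ t, ((1 / δ) * deriv Real.smoothTransition ((τ - δ - t) / δ)) * Y t ≤
        (∫ t, ((1 / δ) * deriv Real.smoothTransition ((t - δ) / δ)) * Y t) +
        (∫ t, timePlateau δ τ t * Y t) +
        K₀ * (∫⁻ t, ENNReal.ofReal (timePlateau δ τ t * (P t * Y t))).toReal + a τ := by
    intro δ τ hδ hδτ hτ1
    have hτ : 0 < τ := by linarith
    have hC2 := h2.windowed_energy_bound hu₀ hdiv hG' hG'2 hLEI' hc₁ hK₀ hcut htri x₀ hδ hδτ
      (by linarith : τ < 2)
    obtain ⟨hint, hle⟩ := hrem 2 u₀ u (fun t x => p t x - c' t) G x₀ hu₀ hM h2 hGT hE2 hA2 hP2 τ hτ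
      hτ1.le (by linarith)
    have hsub : Ioo (δ / 2) τ ×ˢ ball x₀ 3 ⊆ Ioo 0 τ ×ˢ ball x₀ 3 :=
      prod_mono (Ioo_subset_Ioo (by linarith) le_rfl) Subset.rfl
    have hmn := setIntegral_mono_set hint
      (Eventually.of_forall fun z => by simp only [Pi.zero_apply]; positivity)
      (Eventually.of_forall fun z hz => hsub hz)
    exact hC2.trans (add_le_add le_rfl (hmn.trans hle))
  -- ### Grönwall (the real-variable layer)
  have hdecay := decay_of_window (Y := Y) (P := P) (a := a) hY0 hYm hYb hYlim hP0 hPfin hK₀ ha0 hmono hwin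
  -- ### conclusion on `B(x₀, 1)`, where `θ = 1`
  have hexp : Real.exp (1 + K₀ * (∫⁻ t in Ioo (0 : ℝ) 1, ENNReal.ofReal (P t)).toReal) ≤ Kexp := by
    rw [hKexp]
    refine Real.exp_le_exp.2 (add_le_add le_rfl (mul_le_mul_of_nonneg_left ?_ hK₀))
    exact ENNReal.toReal_mono hCGM hPle
  filter_upwards [hdecay, hslice, hE1, ae_restrict_mem measurableSet_Ioo] with t hdec hst hEt ht
  -- integrability of `θ |w(t)|²` at this time
  have hwm : AEStronglyMeasurable (fun x => u t x - e t x) volume :=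
    hst.1.sub (he_cont t ht.1).aestronglyMeasurable
  have hwfin : ∫⁻ x in ball x₀ 3, ‖u t x - e t x‖ₑ ^ 2 < ∞ := by
    have hm : AEMeasurable (fun x => ‖e t x - (0 : EuclideanSpace ℝ (Fin 3))‖ₑ ^ 2)
        (volume.restrict (ball x₀ 3)) :=
      (((he_cont t ht.1).aestronglyMeasurable.sub aestronglyMeasurable_const).aemeasurable.enorm.pow_const _)
    refine (setLIntegral_enorm_sub_sq_le hm).trans_lt ?_
    simp only [sub_zero]
    refine ENNReal.add_lt_top.2 ⟨ENNReal.mul_lt_top (by simp) (hEt.trans_lt ENNReal.coe_lt_top),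
      ENNReal.mul_lt_top (by simp) ((hM2V t ht.1).trans_lt ?_)⟩
    exact ENNReal.mul_lt_top (ENNReal.pow_lt_top ENNReal.coe_lt_top) hV3fin.lt_top
  have hIw : IntegrableOn (fun x => ‖u t x - e t x‖ ^ 2) (ball x₀ 3) volume := by
    refine ⟨(hwm.norm.pow 2).restrict, ?_⟩
    rw [hasFiniteIntegral_iff_enorm]
    refine lt_of_le_of_lt (lintegral_mono fun x => le_of_eq ?_) hwfin
    rw [Real.enorm_eq_ofReal (sq_nonneg _), ← ofReal_norm, ENNReal.ofReal_pow (norm_nonneg _)]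
  have hIθ : Integrable (fun x => cutoff (1 : ℝ) (x - x₀) ^ 2 * ‖u t x - e t x‖ ^ 2) volume := by
    have h1 : IntegrableOn (fun x => cutoff (1 : ℝ) (x - x₀) ^ 2 * ‖u t x - e t x‖ ^ 2) (ball x₀ 3) volume :=
      Integrable.bdd_mul hIw ((((contDiff_cutoff (E := EuclideanSpace ℝ (Fin 3)) (n := 0) 1).continuous.comp
        (continuous_id.sub continuous_const)).pow 2).aestronglyMeasurable)
        (Eventually.of_forall fun x => by
          rw [Real.norm_eq_abs, abs_of_nonneg (sq_nonneg _)]; exact hθ1 x)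
    rw [← integrable_indicator_iff measurableSet_ball] at h1
    refine h1.congr (Eventually.of_forall fun x => ?_)
    dsimp only
    by_cases hx : x ∈ ball x₀ 3
    · rw [indicator_of_mem hx]
    · rw [indicator_of_notMem hx, hθ0 x hx]; simp
  -- `∫_{B₁} |w|² ≤ Y(t)`
  have hB1 : ∫⁻ x in ball x₀ 1, ‖u t x - e t x‖ₑ ^ 2 ≤ ENNReal.ofReal (Y t) := by
    have hY : ENNReal.ofReal (Y t) = ∫⁻ x, ENNReal.ofReal (cutoff (1 : ℝ) (x - x₀) ^ 2 * ‖u t x - e t x‖ ^ 2) :=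
      ofReal_integral_eq_lintegral_ofReal hIθ (Eventually.of_forall fun x => by positivity)
    rw [hY, ← lintegral_indicator measurableSet_ball]
    refine lintegral_mono fun x => ?_
    by_cases hx : x ∈ ball x₀ 1
    · rw [indicator_of_mem hx, hθone x hx, one_pow, one_mul, ← ofReal_norm,
        ENNReal.ofReal_pow (norm_nonneg _)]
    · rw [indicator_of_notMem hx]; exact zero_le
  -- assemble
  have hYt : Y t ≤ a t * Kexp :=
    hdec.trans (mul_le_mul_of_nonneg_left hexp (ha0 t))
  have hrt : eLpNorm (u t - heatTest 1 u₀ t) 2 (volume.restrict (ball x₀ 1)) =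
      (∫⁻ x in ball x₀ 1, ‖u t x - e t x‖ₑ ^ 2) ^ (1 / 2 : ℝ) := by
    rw [eLpNorm_eq_lintegral_rpow_enorm_toReal two_ne_zero ENNReal.ofNat_ne_top]
    simp only [ENNReal.toReal_ofNat, ENNReal.rpow_ofNat, one_div]
    rfl
  rw [hrt]
  calc (∫⁻ x in ball x₀ 1, ‖u t x - e t x‖ₑ ^ 2) ^ (1 / 2 : ℝ)
      ≤ (ENNReal.ofReal (a t * Kexp)) ^ (1 / 2 : ℝ) :=
        ENNReal.rpow_le_rpow (hB1.trans (ENNReal.ofReal_le_ofReal hYt)) (by norm_num)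
    _ = ((Real.sqrt (a t * Kexp)).toNNReal : ℝ≥0∞) := by
        rw [ENNReal.ofReal_rpow_of_nonneg (mul_nonneg (ha0 t) hKexp0) (by norm_num),
          ← Real.sqrt_eq_rpow]
        rfl

end Main

end Literature.Analysis.FluidPDE
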